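import Literature.MathematicalPhysics.QuantumFieldTheory.Balaban1983to89.B8Prop3GaugeFixedKLevelSrc
import Literature.MathematicalPhysics.QuantumFieldTheory.Balaban1983to89.B8LeafModelZd3

/-!
# `Balaban1983to89.B8Prop3SrcZd3` — [Balaban1985RegularSpaces] **PROPOSITION 3 WITH SOURCE** (Prop. 3 p. 87 «inspected» for the sourced gauge
# condition (1.146), Sect. H p. 101) AT NODE 00's CARRIER `zdGF3`: the four members of (1.62) in norm form and the Hölder member with additive
# source terms in the in-edge (1.59) (`apriori_160_src4`, `apriori_160_fifth_src`, `prop3_norms_kLevel_src4`, `prop3_fifth_kLevel_src`), and the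
# sourced-Proposition-3 socket `SP3src` of `B8Thm8SurvivingZd3.thm8SurvivingAt_zd3_univ_lan` SUPPLIED from the primitive sourced b9 socket in
# Proposition 3's frame (`sp3src_zd3_of_sockB9P3src`)

statement-level skeleton of published theorems with citation tags; proofs where landed; nothing here is a claim about the Yang–Mills mass gap

T. Bałaban, *Spaces of regular gauge field configurations on a lattice and gauge fixing conditions*, Commun. Math. Phys. **99** (1985) 75–102
`[Balaban1985RegularSpaces]` ("B8"; journal page = PDF page + 74): Prop. 3 p. 87 with (1.55)–(1.62) pp. 86–87, (1.36)–(1.42) pp. 82–83, Sect. H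
p. 101; [4] = [Balaban1985BackgroundPropagators] Thm 3.3 p. 398 (the in-edge (1.59)).

## WHY THIS FILE (cell `pub-ymgap`, HUMAN RULING D-0062; R134 seat `pub-ymgap-dag-n05-c` g4, DAG node N05 = [B8]; count-neutral)

Fifth brick of `t8S`.  `B8Thm8SurvivingZd3.thm8SurvivingAt_zd3_univ_lan` (Theorem 8 in its surviving form at the carrier, this seat) displays ONE composite socket
`SP3src` = «Proposition 3 with source»: (1.40)–(1.42) with (1.146) and `|f|₍₋₂₎, |D f|₍₋₃₎ < γ(α₀ + α₁)` ⇒ (1.36), (1.39).  Proposition 3's own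
argument (the bootstrap (1.55) + (1.56) + (1.59) ⇒ (1.60) ⇒ (1.62), pp. 86–87) is [B8]-own printed content; print p. 101 says it survives the
source «almost without any changes, only some constants change their numerical values».  THIS FILE proves exactly that at the carrier and
REDUCES `SP3src` to the primitive sourced in-edge in Proposition 3's frame — the five (1.59)-lines of n05-a's `B8LeafModelZd3.SockB9P3` with
(1.146) for (1.38), the source premisses, and additive source terms `+ γ″B₀(α₀ + α₁)` (four lines) ∕ `+ γβ(α₀ + α₁)` (Hölder line):

* §1 `apriori_160_src4`, `apriori_160_fifth_src` — the real-arithmetic bootstrap with sources on all five lines (cf. `B8.apriori_160`,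
  `B8Prop3Holder.apriori_160_fifth`; `B8Prop3GaugeFixedKLevelSrc.apriori_160_src` is the two-line case): `a ≤ P + S_a + S_g`, `g ≤ P + 2S_g`,
  `j₂ ≤ P + S_j + S_g`, `l ≤ P + S_l + S_g`, `h ≤ P′ + 2B₀(β)S_g + S_h` (`72dα₂ ≤ 2` from `50dα₂ ≤ 1` absorbs the gradient's source into the Hölder line).
* §2 `prop3_norms_kLevel_src4`, `prop3_fifth_kLevel_src` — n05-b's `B8Prop3KLevel.prop3_norms_kLevel` ∕ `prop3_fifth_kLevel` with the sourced (1.59)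
  ((1.55) `B8Eq155KLevelLocal.eq155_norm_kLevel_hermitian`, (1.56) `B8Eq156KLevelLocal.wsup_B1_le_kLevel`, (1.62) `B8.apriori_162` BY NAME).
* §3 ★ `sp3src_zd3_of_sockB9P3src` — n05-a's `B8LeafModelZd3.prop3Printed_zd3` RE-RUN with the sourced in-edge `SB9src` (per member) and the carrier's
  (1.146) `LandauF`: ∃ ONE threshold such that the `SP3src` binder of `thm8SurvivingAt_zd3_univ_lan` holds at EVERY member with constants
  `5dL·B₈`, `5dL·B₈β` whenever `5dLB₀ + 2γ″B₀ ≤ 5dLB₈` and `5dL·B₀β + 2B₀β·γ″B₀ + γβ ≤ 5dL·B₈β` (print's «only some constants change»).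
  With this file the five sockets of `thm8SurvivingAt_zd3_univ_lan` are ALL primitive: Prop. 5 ∃∕! at the sourced gauge condition and [4] Thm 3.3
  WITH SOURCE in the two frames (Thm 4's `SH59src`, Prop. 3's `SB9src`).
* §3 (v1.1) `sp3src_zd3_map_of_sockB9P3src` — the same RE-KEYED ι-GENERIC (sockets at `ι a` only, any `ι : J → ZdIdx d L`; №53∕№55 discipline,
  n05-d g5's located point: the `∀ i : ZdIdx`-keyed binder is prima facie unsatisfiable at members with `Λb ≡ ∅`).

## HONEST SCOPE

Real arithmetic + the cited k-level estimates BY NAME; NO new estimate of [Balaban1985RegularSpaces] or [4]; the sourced in-edge `SB9src` is a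
HYPOTHESIS per member ([4] Thm 3.3 applied to (1.57)–(1.58) with the source — its provider is NOT in the tree; the source constants `γ″, γβ ≥ 0`
are free).  `d ≥ 2`; `T_η ↦ ℤᵈ`; `≤`∕`<` as in the carrier.  Count-neutral; N05 NOT discharged; one finite `T⁴` programme at fixed `ε`, Bałaban as
printed — nothing continuum ∕ ℝ⁴ ∕ OS ∕ mass-gap ∕ Clay.  No `sorry`, no `axiom`, no definition, no `instance`.  Unit `pub-ymgap-dag-n05-c` (g4),
2026-08-27.

[cite: Balaban1985RegularSpaces, Prop. 3 p.87, (1.55)–(1.62) pp.86–87, (1.36)–(1.42) pp.82–83, Thm 8 (1.146) p.101; Balaban1985BackgroundPropagators, Thm 3.3 p.398]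
-/

noncomputable section

open NormedSpace

namespace Literature.MathematicalPhysics.QuantumFieldTheory.Balaban1983to89.B8Prop3SrcZd3

open Complex (I)
open MatrixLog B7Prop1Explicit B7Prop2Explicit B7Prop1Local B7Eq92Concrete
open B7Prop2Explicit (C0 c2' unitaryUnits unitaryUnits_le_U1 avgClosed_unitaryUnits)
open B7Prop3Flat (c3)
open B7Prop4GeneralLevels (logCovIter linCovIter)
open B8Lemma1NonAbelian (mulCfg)
open B8Ineq132 (covDerivFwd InAk BondTouches)
open B8Eq146AExpansion (iEta expCfg plaqCovDeriv)
open B8Eq143PlaqExpansion (pdiv)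
open B8Eq155JBound (Jcur wsup)
open B8Eq140Level (SideTouches)
open B8Eq184Proof (cfgExp)
open B8ScaledSupNorm (bondNorm msup weight Bdd)
open B8Eq155KLevelLocal (eq155_norm_kLevel_hermitian)
open B8Eq156KLevelLocal (wsup_B1_le_kLevel)
open B8Prop3KLevel (bound_of_sideTouches)
open B8Eq138LandauZd (IsLandau146W InR138 logCfg covLap)
open B8Prop3GaugeFixedKLevel (inAk_congr_of_sideTouches expCfg_iEta_eq_cfgExp cfgExp_congr_at)
open B8LeafModelZd (ZdIdx)
open B8LeafModelZd3 (zdGF3 mlogCfg mlogCfg_of_sideTouches mlogCfg_of_not prop3_windows)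
open B9Eq340HolderZd (hquot AdmPair)

-- `Site` alone could resolve to the torus sites of `Setup.lean`; re-export the `ℤ^d` sites of `B7Prop1Explicit`.
export B7Prop1Explicit (Site)

variable {d : ℕ}

/-! ## §1 The bootstrap with additive source terms on all five (1.59)-lines -/

/-- **(1.55) + (1.56) + (1.59)-with-source ⇒ (1.60)-with-source, four lines** (real arithmetic; `B8.apriori_160` is the source-free case; p. 86
«B₀36dα₂ ≤ ½» absorbs half of the gradient quantity, whose source `S_g` therefore enters every line once more).
[cite: Balaban1985RegularSpaces, (1.55)–(1.60) pp.86–87; Thm 8 p.101 («only some constants change»)] -/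
theorem apriori_160_src4 {d L C₂ B₀ α₀ α₁ α₂ nJ nB a g j₂ l Sa Sg Sj Sl : ℝ}
    (hd : 0 ≤ d) (hB₀ : 0 ≤ B₀) (hα₂ : 0 ≤ α₂) (hg : 0 ≤ g)
    (h55 : nJ ≤ 2 * α₀ + 36 * d * α₂ * g + 50 * d * α₂ ^ 3 + 10 * d * α₀ * α₂)
    (h56 : nB ≤ 2 * d * L * α₁ + C₂ * α₂ ^ 2)
    (h59a : a ≤ B₀ * (nJ + nB) + Sa) (h59g : g ≤ B₀ * (nJ + nB) + Sg) (h59j : j₂ ≤ B₀ * (nJ + nB) + Sj)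
    (h59l : l ≤ B₀ * (nJ + nB) + Sl)
    (hside : 36 * d * B₀ * α₂ ≤ 1 / 2) (h50 : 50 * d * α₂ ≤ 1) :
    a ≤ B₀ * (4 * α₀ + 4 * d * L * α₁ + 2 * α₂ ^ 2 + 20 * d * α₀ * α₂ + 2 * C₂ * α₂ ^ 2) + Sa + Sg ∧
    g ≤ B₀ * (4 * α₀ + 4 * d * L * α₁ + 2 * α₂ ^ 2 + 20 * d * α₀ * α₂ + 2 * C₂ * α₂ ^ 2) + 2 * Sg ∧
    j₂ ≤ B₀ * (4 * α₀ + 4 * d * L * α₁ + 2 * α₂ ^ 2 + 20 * d * α₀ * α₂ + 2 * C₂ * α₂ ^ 2) + Sj + Sg ∧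
    l ≤ B₀ * (4 * α₀ + 4 * d * L * α₁ + 2 * α₂ ^ 2 + 20 * d * α₀ * α₂ + 2 * C₂ * α₂ ^ 2) + Sl + Sg := by
  set Y := 2 * α₀ + 50 * d * α₂ ^ 3 + 10 * d * α₀ * α₂ + nB with hY
  have hJB : nJ + nB ≤ Y + 36 * d * α₂ * g := by rw [hY]; linarith
  have hstep : B₀ * (nJ + nB) ≤ B₀ * Y + 36 * d * B₀ * α₂ * g := by
    have := mul_le_mul_of_nonneg_left hJB hB₀
    linarith [this]
  have hθg : 36 * d * B₀ * α₂ * g ≤ (1 / 2) * g := by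
    have := mul_le_mul_of_nonneg_right hside hg
    linarith [this]
  have hg2 : g ≤ 2 * (B₀ * Y) + 2 * Sg := by linarith
  have hdα : 0 ≤ d * α₂ := mul_nonneg hd hα₂
  have hcube : 100 * d * α₂ ^ 3 ≤ 2 * α₂ ^ 2 := by nlinarith [sq_nonneg α₂, hdα]
  have hfin : 2 * (B₀ * Y) ≤
      B₀ * (4 * α₀ + 4 * d * L * α₁ + 2 * α₂ ^ 2 + 20 * d * α₀ * α₂ + 2 * C₂ * α₂ ^ 2) := by
    have hin : 2 * Y ≤ 4 * α₀ + 4 * d * L * α₁ + 2 * α₂ ^ 2 + 20 * d * α₀ * α₂ + 2 * C₂ * α₂ ^ 2 := by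
      rw [hY]; linarith
    have := mul_le_mul_of_nonneg_left hin hB₀
    linarith [this]
  refine ⟨by linarith, by linarith, by linarith, by linarith⟩

/-- **The Hölder line with source** (cf. `B8Prop3Holder.apriori_160_fifth`): with the gradient line sourced by `S_g ≥ 0` and the Hölder line
(constant `B₀(β)`) sourced by `S_h`, `h ≤ B₀(β)·(4α₀ + 4dLα₁ + 2α₂² + 20dα₀α₂ + 2C₂α₂²) + 2B₀(β)S_g + S_h` — the gradient's bootstrap contributes
`72dα₂·S_g ≤ 2S_g` (`50dα₂ ≤ 1`). [cite: Balaban1985RegularSpaces, (1.55)–(1.60) pp.86–87, (1.36) p.82 (Hölder member); Thm 8 p.101] -/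
theorem apriori_160_fifth_src {d L C₂ B₀ B₀' α₀ α₁ α₂ nJ nB g h Sg Sh : ℝ}
    (hd : 0 ≤ d) (hB₀ : 0 ≤ B₀) (hB₀' : 0 ≤ B₀') (hα₀ : 0 ≤ α₀) (hα₂ : 0 ≤ α₂) (hg : 0 ≤ g) (hnB : 0 ≤ nB) (hSg : 0 ≤ Sg)
    (h55 : nJ ≤ 2 * α₀ + 36 * d * α₂ * g + 50 * d * α₂ ^ 3 + 10 * d * α₀ * α₂)
    (h56 : nB ≤ 2 * d * L * α₁ + C₂ * α₂ ^ 2)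
    (h59g : g ≤ B₀ * (nJ + nB) + Sg) (h59h : h ≤ B₀' * (nJ + nB) + Sh)
    (hside : 36 * d * B₀ * α₂ ≤ 1 / 2) (h50 : 50 * d * α₂ ≤ 1) :
    h ≤ B₀' * (4 * α₀ + 4 * d * L * α₁ + 2 * α₂ ^ 2 + 20 * d * α₀ * α₂ + 2 * C₂ * α₂ ^ 2) + 2 * B₀' * Sg + Sh := by
  set Y := 2 * α₀ + 50 * d * α₂ ^ 3 + 10 * d * α₀ * α₂ + nB with hY
  have hdα : 0 ≤ d * α₂ := mul_nonneg hd hα₂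
  have hY0 : 0 ≤ Y := by
    rw [hY]; nlinarith [mul_nonneg hdα (sq_nonneg α₂), mul_nonneg hdα hα₀]
  have hJB : nJ + nB ≤ Y + 36 * d * α₂ * g := by rw [hY]; linarith
  have hstep : B₀ * (nJ + nB) ≤ B₀ * Y + 36 * d * B₀ * α₂ * g := by
    have := mul_le_mul_of_nonneg_left hJB hB₀
    linarith [this]
  have hθg : 36 * d * B₀ * α₂ * g ≤ (1 / 2) * g := by
    have := mul_le_mul_of_nonneg_right hside hg
    linarith [this]
  have hg2 : g ≤ 2 * (B₀ * Y) + 2 * Sg := by linarith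
  -- `36dα₂·g ≤ Y + 2S_g`: `72dB₀α₂ ≤ 1` for the first summand, `72dα₂ ≤ 2` for the second
  have h36 : 0 ≤ 36 * d * α₂ := by positivity
  have h72 : 36 * d * α₂ * g ≤ Y + 2 * Sg := by
    have h1 : 36 * d * α₂ * g ≤ 36 * d * α₂ * (2 * (B₀ * Y) + 2 * Sg) := mul_le_mul_of_nonneg_left hg2 h36
    have h2 : 36 * d * α₂ * (2 * (B₀ * Y) + 2 * Sg) = 2 * (36 * d * B₀ * α₂) * Y + (72 * d * α₂) * Sg := by ring
    have h3 : 2 * (36 * d * B₀ * α₂) * Y ≤ 1 * Y := mul_le_mul_of_nonneg_right (by linarith) hY0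
    have h4 : (72 * d * α₂) * Sg ≤ 2 * Sg := mul_le_mul_of_nonneg_right (by nlinarith [hdα]) hSg
    linarith [h1, h2, h3, h4]
  have hJB2 : nJ + nB ≤ 2 * Y + 2 * Sg := by linarith [hJB, h72]
  have hstep' : B₀' * (nJ + nB) ≤ B₀' * (2 * Y + 2 * Sg) := mul_le_mul_of_nonneg_left hJB2 hB₀'
  have hcube : 100 * d * α₂ ^ 3 ≤ 2 * α₂ ^ 2 := by nlinarith [sq_nonneg α₂, hdα]
  have hin : 2 * Y ≤ 4 * α₀ + 4 * d * L * α₁ + 2 * α₂ ^ 2 + 20 * d * α₀ * α₂ + 2 * C₂ * α₂ ^ 2 := by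
    rw [hY]; linarith
  have hfin := mul_le_mul_of_nonneg_left hin hB₀'
  have e : B₀' * (2 * Y + 2 * Sg) = B₀' * (2 * Y) + 2 * B₀' * Sg := by ring
  linarith [hstep', hfin, e, h59h]

/-! ## §2 Proposition 3 in norm form at `k` levels with the sourced (1.59): all four members and the Hölder member -/

section Prop3

variable {𝔸 : Type*} [CStarAlgebra 𝔸] [Nontrivial 𝔸]

/-- **PROPOSITION 3 IN NORM FORM AT `k` LEVELS, ALL FOUR MEMBERS, SOURCED (1.59)** — n05-b's `B8Prop3KLevel.prop3_norms_kLevel` with additive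
source terms `S_a, S_g, S_j, S_l` on the four (1.59)-lines: `a ≤ 5dLB₀(α₀+α₁) + (S_a + S_g)`, `g ≤ … + 2S_g`, `j₂ ≤ … + (S_j + S_g)`, `l ≤ … + (S_l + S_g)`.
[cite: Balaban1985RegularSpaces, Prop. 3 p.87, (1.55)–(1.62) pp.86–87, Thm 8 p.101] -/
theorem prop3_norms_kLevel_src4 (hd2 : 2 ≤ d) {η : ℝ} (hη : 0 < η) {L : ℕ} (hL : 2 ≤ L) {k : ℕ}
    {U₀ : Site d → Fin d → 𝔸ˣ} (hU₀ : ∀ y κ, U₀ y κ ∈ unitaryUnits 𝔸)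
    {A : Site d → Fin d → 𝔸} (hAh : ∀ y κ, IsSelfAdjoint (A y κ)) {α₀ α₁ α₂ g : ℝ}
    (hα₀ : 0 < α₀) (hα₁ : 0 ≤ α₁) (hα₂ : 0 ≤ α₂) (hg0 : 0 ≤ g)
    (hα3 : C0 d * α₀ ≤ 1 / 3) (hα4 : 4 * α₀ ≤ c2' d L) (h16 : 16 * α₂ ≤ 1) (hd5 : 5 * α₂ * ((d : ℝ) - 1) ≤ 4)
    (hsmall : Real.exp (4 * (800 * ((d : ℝ) + 1) ^ 2 * ((d : ℝ) + 4)) * α₀)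
      * (1 + 8 * (131072 * ((d : ℝ) + 1) ^ 2) * α₂) ≤ 2)
    (hc₃ : 2 * α₂ ≤ c3 d L) {B₀ : ℝ} (hB₀ : 0 ≤ B₀) (hside : 36 * d * B₀ * α₂ ≤ 1 / 2) (h50 : 50 * d * α₂ ≤ 1)
    {C₂ : ℝ} (hC₂ : 8 * (131072 * ((d : ℝ) + 1) ^ 2) * Real.exp (4 * (800 * ((d : ℝ) + 1) ^ 2 * ((d : ℝ) + 4)) * α₀) ≤ C₂)
    (h61 : 2 * α₂ ^ 2 + 20 * d * α₀ * α₂ + 2 * C₂ * α₂ ^ 2 ≤ α₀ + α₁)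
    {Ω : ℕ → Set (Site d)} {Λ : ℕ → Set (Site d × Fin d)}
    (hbox : ∀ j, j ≤ k → ∀ c ∈ Λ j, ∀ x, InBox (loK L j c.1) (bondHiK L j c.1 c.2) x → x ∈ Ω j)
    (h40₀ : InAk L k η α₀ Ω U₀) (h40₁ : InAk L k η α₀ Ω (mulCfg (expCfg (iEta η A)) U₀))
    (h41 : ∀ j, j ≤ k → ∀ y τ, SideTouches (Ω j) y τ → ‖A y τ‖ ≤ α₂ * ((L : ℝ) ^ j * η)⁻¹)
    (hg : ∀ j, j ≤ k → ∀ (y : Site d) (κ τ : Fin d), SideTouches (Ω j) y τ →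
      ((L : ℝ) ^ j * η) ^ 2 * ‖covDerivFwd η U₀ κ (fun z => A z τ) y‖ ≤ g)
    (h42 : ∀ j, j ≤ k → ∀ c ∈ Λ j, ‖logCovIter L U₀ (iEta η A) j c.1 c.2‖ < 2 * d * L * α₁)
    {a j₂ l Sa Sg Sj Sl : ℝ}
    (h59a : a ≤ B₀ * (bondNorm L k η (-(3 : ℝ)) Ω (fun x μ => Jcur η U₀ A μ x)
      + wsup 1 (fun p : {p : ℕ × (Site d × Fin d) // p.1 ≤ k ∧ p.2 ∈ Λ p.1} =>
          linCovIter L U₀ (iEta η A) p.1.1 p.1.2.1 p.1.2.2)) + Sa)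
    (h59g : g ≤ B₀ * (bondNorm L k η (-(3 : ℝ)) Ω (fun x μ => Jcur η U₀ A μ x)
      + wsup 1 (fun p : {p : ℕ × (Site d × Fin d) // p.1 ≤ k ∧ p.2 ∈ Λ p.1} =>
          linCovIter L U₀ (iEta η A) p.1.1 p.1.2.1 p.1.2.2)) + Sg)
    (h59j : j₂ ≤ B₀ * (bondNorm L k η (-(3 : ℝ)) Ω (fun x μ => Jcur η U₀ A μ x)
      + wsup 1 (fun p : {p : ℕ × (Site d × Fin d) // p.1 ≤ k ∧ p.2 ∈ Λ p.1} =>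
          linCovIter L U₀ (iEta η A) p.1.1 p.1.2.1 p.1.2.2)) + Sj)
    (h59l : l ≤ B₀ * (bondNorm L k η (-(3 : ℝ)) Ω (fun x μ => Jcur η U₀ A μ x)
      + wsup 1 (fun p : {p : ℕ × (Site d × Fin d) // p.1 ≤ k ∧ p.2 ∈ Λ p.1} =>
          linCovIter L U₀ (iEta η A) p.1.1 p.1.2.1 p.1.2.2)) + Sl) :
    a ≤ 5 * d * L * B₀ * (α₀ + α₁) + (Sa + Sg) ∧ g ≤ 5 * d * L * B₀ * (α₀ + α₁) + 2 * Sg ∧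
    j₂ ≤ 5 * d * L * B₀ * (α₀ + α₁) + (Sj + Sg) ∧ l ≤ 5 * d * L * B₀ * (α₀ + α₁) + (Sl + Sg) := by
  have hL1 : 1 ≤ L := le_trans (by norm_num) hL
  have h₀ : ∀ y κ, U₀ y κ ∈ U1 𝔸 := fun y κ => unitaryUnits_le_U1 (hU₀ y κ)
  -- (1.55) at `k` levels (`B8Eq155KLevelLocal`)
  have h55 := eq155_norm_kLevel_hermitian hη hL1 h₀ hAh hα₀.le hα₂ h16 hd5 hg0 h40₀ h40₁ h41 hg
  -- (1.56) at `k` levels (`B8Eq156KLevelLocal`), with (1.41) moved to the bonds touching `Ω_j`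
  have h41' : ∀ j, j ≤ k → ∀ x μ, BondTouches (Ω j) x μ → ‖A x μ‖ ≤ α₂ * ((L : ℝ) ^ j * η)⁻¹ :=
    fun j hj x μ hb => bound_of_sideTouches hd2 (h41 j hj) x μ hb
  have h56 := wsup_B1_le_kLevel hη L hL (avgClosed_unitaryUnits d L) U₀ hU₀ hα₀ hα3 hα4 A hα₂ hsmall hc₃ hbox h40₀
    h41' hα₁ h42
  -- the bootstrap (1.55) + (1.56) + (1.59) ⇒ (1.60), with `C₂(d, α₀)`
  obtain ⟨ha, hg', hj, hl⟩ := apriori_160_src4 (Nat.cast_nonneg d) hB₀ hα₂ hg0 h55 h56 h59a h59g h59j h59l hside h50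
  -- `C₂(d, α₀) ≤ C₂`, so (1.60) holds with `C₂`
  set R₀ := B₀ * (4 * α₀ + 4 * d * L * α₁ + 2 * α₂ ^ 2 + 20 * d * α₀ * α₂
      + 2 * (8 * (131072 * ((d : ℝ) + 1) ^ 2) * Real.exp (4 * (800 * ((d : ℝ) + 1) ^ 2 * ((d : ℝ) + 4)) * α₀))
        * α₂ ^ 2) with hR₀
  set R₁ := B₀ * (4 * α₀ + 4 * d * L * α₁ + 2 * α₂ ^ 2 + 20 * d * α₀ * α₂ + 2 * C₂ * α₂ ^ 2) with hR₁
  have hR : R₀ ≤ R₁ := by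
    rw [hR₀, hR₁]
    apply mul_le_mul_of_nonneg_left _ hB₀
    have hsq : 0 ≤ α₂ ^ 2 := sq_nonneg _
    nlinarith [mul_le_mul_of_nonneg_right hC₂ hsq]
  -- (1.60) + (1.61) ⇒ (1.62) (`B8.apriori_162`)
  have hd' : (1 : ℝ) ≤ d := by exact_mod_cast (le_trans (by norm_num) hd2)
  have hdL : (1 : ℝ) ≤ (d : ℝ) * L := by
    have hL' : (1 : ℝ) ≤ L := by exact_mod_cast hL1
    nlinarith
  have h162 : R₁ ≤ 5 * d * L * B₀ * (α₀ + α₁) := by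
    rw [hR₁]
    exact B8.apriori_162 hB₀ hdL hα₀.le hα₁ h61
  exact ⟨by linarith [hR.trans h162], by linarith [hR.trans h162], by linarith [hR.trans h162], by linarith [hR.trans h162]⟩

/-- **(1.62), HÖLDER MEMBER, AT `k` LEVELS, SOURCED (1.59)** — n05-b's `B8Prop3KLevel.prop3_fifth_kLevel` with the gradient line sourced by
`S_g ≥ 0` and the Hölder line by `S_h`: `h ≤ 5dL·B₀(β)·(α₀ + α₁) + 2B₀(β)S_g + S_h`. [cite: Balaban1985RegularSpaces, Prop. 3 (1.62) p.87, (1.36) p.82, (1.59)–(1.61) p.86, Thm 8 p.101] -/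
theorem prop3_fifth_kLevel_src (hd2 : 2 ≤ d) {η : ℝ} (hη : 0 < η) {L : ℕ} (hL : 2 ≤ L) {k : ℕ}
    {U₀ : Site d → Fin d → 𝔸ˣ} (hU₀ : ∀ y κ, U₀ y κ ∈ unitaryUnits 𝔸)
    {A : Site d → Fin d → 𝔸} (hAh : ∀ y κ, IsSelfAdjoint (A y κ)) {α₀ α₁ α₂ g : ℝ}
    (hα₀ : 0 < α₀) (hα₁ : 0 ≤ α₁) (hα₂ : 0 ≤ α₂) (hg0 : 0 ≤ g)
    (hα3 : C0 d * α₀ ≤ 1 / 3) (hα4 : 4 * α₀ ≤ c2' d L) (h16 : 16 * α₂ ≤ 1) (hd5 : 5 * α₂ * ((d : ℝ) - 1) ≤ 4)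
    (hsmall : Real.exp (4 * (800 * ((d : ℝ) + 1) ^ 2 * ((d : ℝ) + 4)) * α₀)
      * (1 + 8 * (131072 * ((d : ℝ) + 1) ^ 2) * α₂) ≤ 2)
    (hc₃ : 2 * α₂ ≤ c3 d L) {B₀ B₀β : ℝ} (hB₀ : 0 ≤ B₀) (hB₀β : 0 ≤ B₀β) (hside : 36 * d * B₀ * α₂ ≤ 1 / 2)
    (h50 : 50 * d * α₂ ≤ 1)
    {C₂ : ℝ} (hC₂ : 8 * (131072 * ((d : ℝ) + 1) ^ 2) * Real.exp (4 * (800 * ((d : ℝ) + 1) ^ 2 * ((d : ℝ) + 4)) * α₀) ≤ C₂)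
    (h61 : 2 * α₂ ^ 2 + 20 * d * α₀ * α₂ + 2 * C₂ * α₂ ^ 2 ≤ α₀ + α₁)
    {Ω : ℕ → Set (Site d)} {Λ : ℕ → Set (Site d × Fin d)}
    (hbox : ∀ j, j ≤ k → ∀ c ∈ Λ j, ∀ x, InBox (loK L j c.1) (bondHiK L j c.1 c.2) x → x ∈ Ω j)
    (h40₀ : InAk L k η α₀ Ω U₀) (h40₁ : InAk L k η α₀ Ω (mulCfg (expCfg (iEta η A)) U₀))
    (h41 : ∀ j, j ≤ k → ∀ y τ, SideTouches (Ω j) y τ → ‖A y τ‖ ≤ α₂ * ((L : ℝ) ^ j * η)⁻¹)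
    (hg : ∀ j, j ≤ k → ∀ (y : Site d) (κ τ : Fin d), SideTouches (Ω j) y τ →
      ((L : ℝ) ^ j * η) ^ 2 * ‖covDerivFwd η U₀ κ (fun z => A z τ) y‖ ≤ g)
    (h42 : ∀ j, j ≤ k → ∀ c ∈ Λ j, ‖logCovIter L U₀ (iEta η A) j c.1 c.2‖ < 2 * d * L * α₁)
    {h Sg Sh : ℝ} (hSg : 0 ≤ Sg)
    (h59g : g ≤ B₀ * (bondNorm L k η (-(3 : ℝ)) Ω (fun x μ => Jcur η U₀ A μ x)
      + wsup 1 (fun p : {p : ℕ × (Site d × Fin d) // p.1 ≤ k ∧ p.2 ∈ Λ p.1} =>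
          linCovIter L U₀ (iEta η A) p.1.1 p.1.2.1 p.1.2.2)) + Sg)
    (h59h : h ≤ B₀β * (bondNorm L k η (-(3 : ℝ)) Ω (fun x μ => Jcur η U₀ A μ x)
      + wsup 1 (fun p : {p : ℕ × (Site d × Fin d) // p.1 ≤ k ∧ p.2 ∈ Λ p.1} =>
          linCovIter L U₀ (iEta η A) p.1.1 p.1.2.1 p.1.2.2)) + Sh) :
    h ≤ 5 * d * L * B₀β * (α₀ + α₁) + (2 * B₀β * Sg + Sh) := by
  have hL1 : 1 ≤ L := le_trans (by norm_num) hL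
  have h₀ : ∀ y κ, U₀ y κ ∈ U1 𝔸 := fun y κ => unitaryUnits_le_U1 (hU₀ y κ)
  have h55 := eq155_norm_kLevel_hermitian hη hL1 h₀ hAh hα₀.le hα₂ h16 hd5 hg0 h40₀ h40₁ h41 hg
  have h41' : ∀ j, j ≤ k → ∀ x μ, BondTouches (Ω j) x μ → ‖A x μ‖ ≤ α₂ * ((L : ℝ) ^ j * η)⁻¹ :=
    fun j hj x μ hb => bound_of_sideTouches hd2 (h41 j hj) x μ hb
  have h56 := wsup_B1_le_kLevel hη L hL (avgClosed_unitaryUnits d L) U₀ hU₀ hα₀ hα3 hα4 A hα₂ hsmall hc₃ hbox h40₀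
    h41' hα₁ h42
  have hnB : 0 ≤ wsup 1 (fun p : {p : ℕ × (Site d × Fin d) // p.1 ≤ k ∧ p.2 ∈ Λ p.1} =>
      linCovIter L U₀ (iEta η A) p.1.1 p.1.2.1 p.1.2.2) := B8Eq155JBound.wsup_nonneg zero_le_one _
  have h160 := apriori_160_fifth_src (Nat.cast_nonneg d) hB₀ hB₀β hα₀.le hα₂ hg0 hnB hSg h55 h56 h59g h59h hside h50
  -- `C₂(d, α₀) ≤ C₂`
  have h160' : h ≤ B₀β * (4 * α₀ + 4 * d * L * α₁ + 2 * α₂ ^ 2 + 20 * d * α₀ * α₂ + 2 * C₂ * α₂ ^ 2) + (2 * B₀β * Sg + Sh) := by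
    have hsq : 0 ≤ α₂ ^ 2 := sq_nonneg _
    have hm : B₀β * (4 * α₀ + 4 * d * L * α₁ + 2 * α₂ ^ 2 + 20 * d * α₀ * α₂ +
        2 * (8 * (131072 * ((d : ℝ) + 1) ^ 2) * Real.exp (4 * (800 * ((d : ℝ) + 1) ^ 2 * ((d : ℝ) + 4)) * α₀)) * α₂ ^ 2)
        ≤ B₀β * (4 * α₀ + 4 * d * L * α₁ + 2 * α₂ ^ 2 + 20 * d * α₀ * α₂ + 2 * C₂ * α₂ ^ 2) := by
      apply mul_le_mul_of_nonneg_left _ hB₀β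
      nlinarith [mul_le_mul_of_nonneg_right hC₂ hsq]
    linarith [h160, hm]
  have hd' : (1 : ℝ) ≤ d := by exact_mod_cast (le_trans (by norm_num) hd2)
  have hdL : (1 : ℝ) ≤ (d : ℝ) * L := by
    have hL' : (1 : ℝ) ≤ L := by exact_mod_cast hL1
    nlinarith
  have h162 := B8.apriori_162 hB₀β hdL hα₀.le hα₁ h61
  linarith [h160', h162]

end Prop3

/-! ## §3 The sourced-Proposition-3 socket of `thm8SurvivingAt_zd3_univ_lan` from the primitive sourced in-edge in Proposition 3's frame -/

section Zd3

variable {𝔸 : Type} [CStarAlgebra 𝔸] [Nontrivial 𝔸]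

/-- **PROPOSITION 3 WITH SOURCE AT THE CARRIER `zdGF3` — the socket `SP3src` of `B8Thm8SurvivingZd3.thm8SurvivingAt_zd3_univ_lan` SUPPLIED**
from the primitive sourced in-edge `SB9src` ([4] Thm 3.3 + (1.57)–(1.58) for the sourced gauge condition (1.146), per member: the five (1.59)-lines of
`B8LeafModelZd3.SockB9P3` with source terms `+ γ″B₀(α₀ + α₁)` ∕ `+ γβ(α₀ + α₁)` and the source premisses «`f ∈ R(U₀)`», `|f|₍₋₂₎, |D f|₍₋₃₎ <
γ(α₀ + α₁)`): ONE threshold `c = min(cP, c_N(d, L, B₀))` such that at EVERY member, for `0 < α₀, α₁, α₂ ≤ c` with (1.61) at `C₂ = 2·2097152(d+1)²`,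
every `(U₀, P′, f)` with the source premisses, (1.40) for `U₀` and the pair, (1.41) in the (1.62)-shape `C162 1 α₂`, (1.146) `LandauF U₀ f P′` and
(1.42) `C137 α₁` satisfies (1.36) `C136 (5dL·B₈) (5dL·B₈β) (α₀ + α₁)` and (1.39) `C139 (5dL·B₈) (α₀ + α₁)` — for ANY `B₈, B₈β` with
`5dLB₀ + 2γ″B₀ ≤ 5dLB₈`, `5dL·B₀β + 2B₀β·γ″B₀ + γβ ≤ 5dL·B₈β` (print p. 101 «only some constants change»).  n05-a's `prop3Printed_zd3` VERBATIM with
`prop3_norms_kLevel_src4` ∕ `prop3_fifth_kLevel_src` for n05-b's theorems and the sourced socket. [cite: Balaban1985RegularSpaces, Prop. 3 p.87, (1.40)–(1.42) p.83, (1.59)–(1.62) pp.86–87, (1.36)–(1.39) p.82, Thm 8 (1.146) p.101] -/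
theorem sp3src_zd3_of_sockB9P3src (hd2 : 2 ≤ d) {L : ℕ} (hL : 2 ≤ L) {B₀ B₀β cP γ γ'' γβ B₈ B₈β : ℝ} (hB₀ : 0 < B₀) (hB₀β : 0 ≤ B₀β)
    (hcP : 0 < cP) (hγ'' : 0 ≤ γ'') (hB8 : 5 * (d : ℝ) * L * B₀ + 2 * (γ'' * B₀) ≤ 5 * (d : ℝ) * L * B₈)
    (hB8β : 5 * (d : ℝ) * L * B₀β + 2 * B₀β * (γ'' * B₀) + γβ ≤ 5 * (d : ℝ) * L * B₈β) (β : ℝ) (len : Site d → ℝ)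
    (SB9src : ∀ i : ZdIdx d L, ∀ α₀ α₁ α₂ : ℝ, 0 < α₀ → α₀ ≤ cP → 0 < α₁ → 0 < α₂ → α₂ ≤ cP →
      ∀ (U₀ W : Site d → Fin d → 𝔸ˣ), (∀ x κ, U₀ x κ ∈ unitaryUnits 𝔸) → (∀ x κ, W x κ ∈ unitaryUnits 𝔸) →
      ∀ f : Site d → 𝔸, InR138 L i.k i.η (i.Ω 0) (i.Λs i.k) U₀ f →
      msup L i.k i.η (-(2 : ℝ)) (fun j (x : Site d) => x ∈ i.Ω j) f < γ * (α₀ + α₁) →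
      msup L i.k i.η (-(3 : ℝ)) (fun j (p : Fin d × Site d) => p.2 ∈ i.Ω j) (fun p => covDerivFwd i.η U₀ p.1 f p.2) < γ * (α₀ + α₁) →
      InAk L i.k i.η α₀ i.Ω U₀ → InAk L i.k i.η α₀ i.Ω (mulCfg W U₀) → IsLandau146W L i.k i.η (i.Ω 0) (i.Λs i.k) U₀ f W →
      ∀ A' : Site d → Fin d → 𝔸, (∀ y τ, IsSelfAdjoint (A' y τ)) →
      (∀ j, j ≤ i.k → ∀ (y : Site d) (τ : Fin d), SideTouches (i.Ω j) y τ →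
        W y τ = cfgExp i.η A' y τ ∧ ‖A' y τ‖ ≤ α₂ * ((L : ℝ) ^ j * i.η)⁻¹) →
      (∀ (y : Site d) (τ : Fin d), (∀ j, j ≤ i.k → ¬ SideTouches (i.Ω j) y τ) → A' y τ = 0) →
      msup L i.k i.η (-(1 : ℝ)) (fun j (b : Site d × Fin d) => SideTouches (i.Ω j) b.1 b.2) (fun b => A' b.1 b.2)
          ≤ B₀ * (bondNorm L i.k i.η (-(3 : ℝ)) i.Ω (fun x μ => Jcur i.η U₀ A' μ x)
            + wsup 1 (fun p : {p : ℕ × (Site d × Fin d) // p.1 ≤ i.k ∧ p.2 ∈ i.Λb i.k p.1} =>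
                linCovIter L U₀ (iEta i.η A') p.1.1 p.1.2.1 p.1.2.2)) + γ'' * B₀ * (α₀ + α₁) ∧
        msup L i.k i.η (-(2 : ℝ)) (fun j (t : Fin d × Fin d × Site d) => SideTouches (i.Ω j) t.2.2 t.2.1)
            (fun t => covDerivFwd i.η U₀ t.1 (fun z => A' z t.2.1) t.2.2)
          ≤ B₀ * (bondNorm L i.k i.η (-(3 : ℝ)) i.Ω (fun x μ => Jcur i.η U₀ A' μ x)
            + wsup 1 (fun p : {p : ℕ × (Site d × Fin d) // p.1 ≤ i.k ∧ p.2 ∈ i.Λb i.k p.1} =>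
                linCovIter L U₀ (iEta i.η A') p.1.1 p.1.2.1 p.1.2.2)) + γ'' * B₀ * (α₀ + α₁) ∧
        bondNorm L i.k i.η (-(3 : ℝ)) i.Ω (fun x μ => pdiv i.η U₀ (plaqCovDeriv i.η U₀ A') μ x)
          ≤ B₀ * (bondNorm L i.k i.η (-(3 : ℝ)) i.Ω (fun x μ => Jcur i.η U₀ A' μ x)
            + wsup 1 (fun p : {p : ℕ × (Site d × Fin d) // p.1 ≤ i.k ∧ p.2 ∈ i.Λb i.k p.1} =>
                linCovIter L U₀ (iEta i.η A') p.1.1 p.1.2.1 p.1.2.2)) + γ'' * B₀ * (α₀ + α₁) ∧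
        bondNorm L i.k i.η (-(3 : ℝ)) i.Ω (fun x μ => covLap i.η U₀ (fun z => A' z μ) x)
          ≤ B₀ * (bondNorm L i.k i.η (-(3 : ℝ)) i.Ω (fun x μ => Jcur i.η U₀ A' μ x)
            + wsup 1 (fun p : {p : ℕ × (Site d × Fin d) // p.1 ≤ i.k ∧ p.2 ∈ i.Λb i.k p.1} =>
                linCovIter L U₀ (iEta i.η A') p.1.1 p.1.2.1 p.1.2.2)) + γ'' * B₀ * (α₀ + α₁) ∧
        msup L i.k i.η (-(2 + β)) (fun j (q : Fin d × Fin d × (Site d × Site d)) => q.2.2 ∈ AdmPair i.η len ∧ q.2.2.1 ∈ i.Ω j)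
            (fun q => hquot i.η β len U₀ (covDerivFwd i.η U₀ q.1 (fun z => A' z q.2.1)) q.2.2)
          ≤ B₀β * (bondNorm L i.k i.η (-(3 : ℝ)) i.Ω (fun x μ => Jcur i.η U₀ A' μ x)
            + wsup 1 (fun p : {p : ℕ × (Site d × Fin d) // p.1 ≤ i.k ∧ p.2 ∈ i.Λb i.k p.1} =>
                linCovIter L U₀ (iEta i.η A') p.1.1 p.1.2.1 p.1.2.2)) + γβ * (α₀ + α₁)) :
    ∃ c : ℝ, 0 < c ∧ ∀ i : ZdIdx d L, ∀ α₀ α₁ α₂ : ℝ, 0 < α₀ → α₀ ≤ c → 0 < α₁ → α₁ ≤ c → 0 < α₂ → α₂ ≤ c →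
      2 * α₂ ^ 2 + 20 * d * α₀ * α₂ + 2 * (2097152 * ((d : ℝ) + 1) ^ 2) * α₂ ^ 2 ≤ α₀ + α₁ →
      ∀ (U₀ : (zdGF3 𝔸 L β len i).Cfg) (P' : (zdGF3 𝔸 L β len i).Pert) (f : Site d → 𝔸),
        (zdGF3 𝔸 L β len i).InR U₀ f → (zdGF3 𝔸 L β len i).fNorm f < γ * (α₀ + α₁) → (zdGF3 𝔸 L β len i).fGrad U₀ f < γ * (α₀ + α₁) →
        (zdGF3 𝔸 L β len i).InA α₀ U₀ → (zdGF3 𝔸 L β len i).InAPair α₀ U₀ P' → (zdGF3 𝔸 L β len i).C162 1 α₂ U₀ P' →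
        (zdGF3 𝔸 L β len i).LandauF U₀ f P' → (zdGF3 𝔸 L β len i).C137 α₁ U₀ P' →
        (zdGF3 𝔸 L β len i).C136 (5 * d * L * B₈) (5 * d * L * B₈β) (α₀ + α₁) U₀ P' ∧
          (zdGF3 𝔸 L β len i).C139 (5 * d * L * B₈) (α₀ + α₁) U₀ P' := by
  have hL1 : 1 ≤ L := le_trans (by norm_num) hL
  have hLr : (1 : ℝ) ≤ L := by exact_mod_cast hL1
  have hB₀' : 0 ≤ B₀ := hB₀.le
  obtain ⟨cN, hcN, hwin⟩ := prop3_windows hd2 hL hB₀'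
  refine ⟨min cP cN, lt_min hcP hcN, ?_⟩
  intro i α₀ α₁ α₂ hα₀ hα₀c hα₁ _ hα₂ hα₂c h61 U₀ P f hInR hfN hfG hInA hPair h162 hLan h137
  have hα₀P : α₀ ≤ cP := hα₀c.trans (min_le_left _ _)
  have hα₂P : α₂ ≤ cP := hα₂c.trans (min_le_left _ _)
  obtain ⟨hα3, hα4, h16, hd5, hsmall, hc₃, hside, h50, hC⟩ :=
    hwin α₀ α₂ hα₀ (hα₀c.trans (min_le_right _ _)) hα₂.le (hα₂c.trans (min_le_right _ _))
  have hC₂' : 8 * (131072 * ((d : ℝ) + 1) ^ 2) * Real.exp (4 * (800 * ((d : ℝ) + 1) ^ 2 * ((d : ℝ) + 4)) * α₀) ≤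
      2097152 * ((d : ℝ) + 1) ^ 2 := hC
  have hS0 : 0 ≤ α₀ + α₁ := by linarith
  have hT0 : 0 ≤ γ'' * B₀ * (α₀ + α₁) := by positivity
  -- the data
  set W : Site d → Fin d → 𝔸ˣ := P.2.1 with hW_def
  have hWu : ∀ x κ, W x κ ∈ unitaryUnits 𝔸 := P.2.2
  have hU₀ : ∀ x κ, U₀.1 x κ ∈ unitaryUnits 𝔸 := U₀.2
  set A : Site d → Fin d → 𝔸 := mlogCfg i.k i.η i.Ω W with hA_def
  -- (1.41) and self-adjointness of the canonical exponent; `W = e^{iηA}` on the `E j`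
  have h41 : ∀ j, j ≤ i.k → ∀ (y : Site d) (τ : Fin d), SideTouches (i.Ω j) y τ →
      W y τ = cfgExp i.η A y τ ∧ ‖A y τ‖ ≤ α₂ * ((L : ℝ) ^ j * i.η)⁻¹ := by
    intro j hj y τ hs
    obtain ⟨hexp, -, hbd⟩ := h162 j hj (y, τ) hs
    have hexp' : W y τ = cfgExp i.η (logCfg i.η W) y τ := hexp
    have hbd' : ‖logCfg i.η W y τ‖ ≤ 1 * α₂ * ((L : ℝ) ^ j * i.η)⁻¹ := hbd
    have hAy : A y τ = logCfg i.η W y τ := mlogCfg_of_sideTouches i.η W hj hs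
    refine ⟨?_, ?_⟩
    · rw [hexp']
      exact cfgExp_congr_at i.η hAy.symm
    · rw [hAy]
      simpa only [one_mul] using hbd'
  have hAsa : ∀ y τ, IsSelfAdjoint (A y τ) := by
    intro y τ
    by_cases hmem : ∃ j, j ≤ i.k ∧ SideTouches (i.Ω j) y τ
    · obtain ⟨j, hj, hs⟩ := hmem
      rw [hA_def, mlogCfg_of_sideTouches i.η W hj hs]
      exact (h162 j hj (y, τ) hs).2.1
    · rw [hA_def, mlogCfg_of_not i.η W fun j hj hs => hmem ⟨j, hj, hs⟩]
      exact IsSelfAdjoint.zero 𝔸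
  have hA0 : ∀ (y : Site d) (τ : Fin d), (∀ j, j ≤ i.k → ¬ SideTouches (i.Ω j) y τ) → A y τ = 0 :=
    fun y τ h => mlogCfg_of_not i.η W h
  -- (1.40)₁ for `e^{iηA}U₀` by locality; the Landau clause for `e^{iηA}` by locality
  have h40₁ : InAk L i.k i.η α₀ i.Ω (mulCfg (expCfg (iEta i.η A)) U₀.1) := by
    refine (inAk_congr_of_sideTouches L i.k i.η α₀ (V := mulCfg W U₀.1) fun j hj y τ hs => ?_).1 hPair
    show W y τ * U₀.1 y τ = expCfg (iEta i.η A) y τ * U₀.1 y τ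
    rw [(h41 j hj y τ hs).1, expCfg_iEta_eq_cfgExp]
  -- the global bound and the gradient datum (bounded family)
  have hAglob : ∀ y τ, ‖A y τ‖ ≤ α₂ * i.η⁻¹ := by
    intro y τ
    by_cases hmem : ∃ j, j ≤ i.k ∧ SideTouches (i.Ω j) y τ
    · obtain ⟨j, hj, hs⟩ := hmem
      have hLj : (1 : ℝ) ≤ (L : ℝ) ^ j := one_le_pow₀ hLr
      have hη0 : 0 < i.η := i.hη
      calc ‖A y τ‖ ≤ α₂ * ((L : ℝ) ^ j * i.η)⁻¹ := (h41 j hj y τ hs).2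
        _ = α₂ * i.η⁻¹ * ((L : ℝ) ^ j)⁻¹ := by rw [mul_inv]; ring
        _ ≤ α₂ * i.η⁻¹ * 1 := by
            apply mul_le_mul_of_nonneg_left (inv_le_one_of_one_le₀ hLj) (by positivity)
        _ = α₂ * i.η⁻¹ := mul_one _
    · rw [hA0 y τ fun j hj hs => hmem ⟨j, hj, hs⟩, norm_zero]
      have hη0 : 0 < i.η := i.hη
      positivity
  have hU₀1 : ∀ x κ, U₀.1 x κ ∈ U1 𝔸 := fun x κ => unitaryUnits_le_U1 (hU₀ x κ)
  have hgrad : ∀ (y : Site d) (κ τ : Fin d), ‖covDerivFwd i.η U₀.1 κ (fun z => A z τ) y‖ ≤ 2 * α₂ * i.η⁻¹ * i.η⁻¹ := by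
    intro y κ τ
    have hη0 : 0 < i.η := i.hη
    unfold covDerivFwd
    rw [norm_smul, norm_inv, Real.norm_eq_abs, abs_of_pos hη0]
    have h1 : ‖B7Eq78Linearization.conjR (U₀.1 y κ) (A (y + e κ) τ) - A y τ‖ ≤ α₂ * i.η⁻¹ + α₂ * i.η⁻¹ := by
      calc ‖B7Eq78Linearization.conjR (U₀.1 y κ) (A (y + e κ) τ) - A y τ‖
          ≤ ‖B7Eq78Linearization.conjR (U₀.1 y κ) (A (y + e κ) τ)‖ + ‖A y τ‖ := norm_sub_le _ _
        _ ≤ α₂ * i.η⁻¹ + α₂ * i.η⁻¹ := by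
            rw [B8Ineq132.norm_conjR (hU₀1 y κ)]
            exact add_le_add (hAglob _ _) (hAglob _ _)
    calc i.η⁻¹ * ‖B7Eq78Linearization.conjR (U₀.1 y κ) (A (y + e κ) τ) - A y τ‖ ≤ i.η⁻¹ * (α₂ * i.η⁻¹ + α₂ * i.η⁻¹) :=
        mul_le_mul_of_nonneg_left h1 (by positivity)
      _ = 2 * α₂ * i.η⁻¹ * i.η⁻¹ := by ring
  have hBg : Bdd L i.k i.η (-(2 : ℝ)) (fun j (t : Fin d × Fin d × Site d) => SideTouches (i.Ω j) t.2.2 t.2.1)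
      (fun t => covDerivFwd i.η U₀.1 t.1 (fun z => A z t.2.1) t.2.2) := by
    have e2 : (-(2 : ℝ)) = -((2 : ℕ) : ℝ) := by norm_num
    rw [e2]
    refine B8ScaledSupNorm.bdd_of_forall (c := 2 * α₂ * ((L : ℝ) ^ i.k) ^ 2) fun j hj t _ => ?_
    rw [B8ScaledSupNorm.weight_neg_natCast L i.η 2 j]
    have hLjk : (L : ℝ) ^ j ≤ (L : ℝ) ^ i.k := pow_le_pow_right₀ hLr hj
    have hLj0 : (0 : ℝ) ≤ (L : ℝ) ^ j := by positivity
    have hη0 : 0 < i.η := i.hη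
    calc ((L : ℝ) ^ j * i.η) ^ 2 * ‖covDerivFwd i.η U₀.1 t.1 (fun z => A z t.2.1) t.2.2‖
        ≤ ((L : ℝ) ^ j * i.η) ^ 2 * (2 * α₂ * i.η⁻¹ * i.η⁻¹) := mul_le_mul_of_nonneg_left (hgrad _ _ _) (by positivity)
      _ = 2 * α₂ * ((L : ℝ) ^ j) ^ 2 := by field_simp
      _ ≤ 2 * α₂ * ((L : ℝ) ^ i.k) ^ 2 := by gcongr
  set g : ℝ := msup L i.k i.η (-(2 : ℝ)) (fun j (t : Fin d × Fin d × Site d) => SideTouches (i.Ω j) t.2.2 t.2.1)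
      (fun t => covDerivFwd i.η U₀.1 t.1 (fun z => A z t.2.1) t.2.2) with hg_def
  have hg0 : 0 ≤ g := B8ScaledSupNorm.msup_nonneg L i.k i.hη.le _ _ _
  have hg : ∀ j, j ≤ i.k → ∀ (y : Site d) (κ τ : Fin d), SideTouches (i.Ω j) y τ →
      ((L : ℝ) ^ j * i.η) ^ 2 * ‖covDerivFwd i.η U₀.1 κ (fun z => A z τ) y‖ ≤ g := by
    intro j hj y κ τ hs
    have h := B8ScaledSupNorm.weight_mul_norm_le_msup hBg hj (i := (κ, τ, y)) hs
    have hw : weight L i.η (-(2 : ℝ)) j = ((L : ℝ) ^ j * i.η) ^ 2 := by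
      have e2 : (-(2 : ℝ)) = -((2 : ℕ) : ℝ) := by norm_num
      rw [e2, B8ScaledSupNorm.weight_neg_natCast L i.η 2 j]
    rw [hw] at h
    exact h
  -- the Landau clause for `e^{iηA}` and the in-edge (1.59), five lines, from the socket
  have hLanA : IsLandau146W L i.k i.η (i.Ω 0) (i.Λs i.k) U₀.1 f W := hLan
  obtain ⟨h59a, h59g, h59j, h59l, h59h⟩ := SB9src i α₀ α₁ α₂ hα₀ hα₀P hα₁ hα₂ hα₂P U₀.1 W hU₀ hWu f hInR hfN hfG hInA hPair hLanA A
    hAsa h41 hA0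
  -- (1.42) = the member's (1.37) clause, on the classified constraint bonds of the top truncation
  have hbox : ∀ j, j ≤ i.k → ∀ c ∈ i.Λb i.k j, ∀ x, InBox (loK L j c.1) (bondHiK L j c.1 c.2) x → x ∈ i.Ω j :=
    fun j hj c hc x hx => i.hbox i.k le_rfl j hj c hc x hx
  have h42 : ∀ j, j ≤ i.k → ∀ c ∈ i.Λb i.k j, ‖logCovIter L U₀.1 (iEta i.η A) j c.1 c.2‖ < 2 * d * L * α₁ := h137
  have h41' : ∀ j, j ≤ i.k → ∀ (y : Site d) (τ : Fin d), SideTouches (i.Ω j) y τ → ‖A y τ‖ ≤ α₂ * ((L : ℝ) ^ j * i.η)⁻¹ :=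
    fun j hj y τ hs => (h41 j hj y τ hs).2
  -- PROPOSITION 3 at `k` levels (n05-b), all four members, and the Hölder member
  obtain ⟨ha, hg', hj, hl⟩ := prop3_norms_kLevel_src4 hd2 i.hη hL hU₀ hAsa hα₀ hα₁.le hα₂.le hg0 hα3 hα4 h16 hd5
    hsmall hc₃ hB₀' hside h50 hC₂' h61 hbox hInA h40₁ h41' hg h42 h59a h59g h59j h59l
  have hh := prop3_fifth_kLevel_src hd2 i.hη hL hU₀ hAsa hα₀ hα₁.le hα₂.le hg0 hα3 hα4 h16 hd5 hsmall hc₃ hB₀' hB₀β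
    hside h50 hC₂' h61 hbox hInA h40₁ h41' hg h42 hT0 h59g h59h
  -- the enlarged constants absorb the source terms
  have hc8 : 5 * (d : ℝ) * L * B₀ * (α₀ + α₁) + (γ'' * B₀ * (α₀ + α₁) + γ'' * B₀ * (α₀ + α₁)) ≤ 5 * (d : ℝ) * L * B₈ * (α₀ + α₁) := by
    have h := mul_le_mul_of_nonneg_right hB8 hS0
    calc 5 * (d : ℝ) * L * B₀ * (α₀ + α₁) + (γ'' * B₀ * (α₀ + α₁) + γ'' * B₀ * (α₀ + α₁))
        = (5 * (d : ℝ) * L * B₀ + 2 * (γ'' * B₀)) * (α₀ + α₁) := by ring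
      _ ≤ 5 * (d : ℝ) * L * B₈ * (α₀ + α₁) := h
  have hc8β : 5 * (d : ℝ) * L * B₀β * (α₀ + α₁) + (2 * B₀β * (γ'' * B₀ * (α₀ + α₁)) + γβ * (α₀ + α₁)) ≤
      5 * (d : ℝ) * L * B₈β * (α₀ + α₁) := by
    have h := mul_le_mul_of_nonneg_right hB8β hS0
    calc 5 * (d : ℝ) * L * B₀β * (α₀ + α₁) + (2 * B₀β * (γ'' * B₀ * (α₀ + α₁)) + γβ * (α₀ + α₁))
        = (5 * (d : ℝ) * L * B₀β + 2 * B₀β * (γ'' * B₀) + γβ) * (α₀ + α₁) := by ring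
      _ ≤ 5 * (d : ℝ) * L * B₈β * (α₀ + α₁) := h
  have ha' : msup L i.k i.η (-(1 : ℝ)) (fun j (b : Site d × Fin d) => SideTouches (i.Ω j) b.1 b.2) (fun b => A b.1 b.2) ≤
      5 * (d : ℝ) * L * B₈ * (α₀ + α₁) := ha.trans hc8
  refine ⟨⟨fun j hj b hb => ?_, hg'.trans (by linarith [hc8]), hh.trans hc8β⟩, hj.trans hc8, hl.trans hc8⟩
  -- (1.36)₁ pointwise on the `E j`, read on the logarithm
  obtain ⟨hexp, hsa, -⟩ := h162 j hj b hb
  refine ⟨hexp, hsa, ?_⟩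
  have hpt := B8Thm2GaugeFixedKLevel.thm2_pointwise_A i.hη hL1 h41' ha' hj (y := b.1) (τ := b.2) hb
  rw [← mlogCfg_of_sideTouches i.η W hj hb]
  exact hpt

/-- **(v1.1) Brick 5 RE-KEYED ι-GENERIC** (the №53∕№55 discipline; `pub-ymgap-dag-n05-d` g5's located junction-shape point, INBOX 03:55Z 08-27: the
sourced b9 socket's `wsup_{Λb}`-term degenerates at members with `Λb ≡ ∅`, so an `∀ i : ZdIdx`-keyed socket binder is prima facie unsatisfiable —
J2′ class): `sp3src_zd3_of_sockB9P3src` for ANY index map `ι : J → ZdIdx d L` with the sourced in-edge `SB9src` asked AT `ι a` ONLY; same memberwise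
proof, same member-free threshold `min(cP, c_N(d, L, B₀))`.  The consumer (the SubB∕zdLan knit face with `t8` supplied, n05-d g5) instantiates
`ι := fun j : IdxB8SubB θ => j.1.1`. [cite: Balaban1985RegularSpaces, Prop. 3 p.87, (1.40)–(1.42) p.83, (1.59)–(1.62) pp.86–87, (1.36)–(1.39) p.82, Thm 8 (1.146) p.101] -/
theorem sp3src_zd3_map_of_sockB9P3src (hd2 : 2 ≤ d) {L : ℕ} (hL : 2 ≤ L) {B₀ B₀β cP γ γ'' γβ B₈ B₈β : ℝ} (hB₀ : 0 < B₀) (hB₀β : 0 ≤ B₀β)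
    (hcP : 0 < cP) (hγ'' : 0 ≤ γ'') (hB8 : 5 * (d : ℝ) * L * B₀ + 2 * (γ'' * B₀) ≤ 5 * (d : ℝ) * L * B₈)
    (hB8β : 5 * (d : ℝ) * L * B₀β + 2 * B₀β * (γ'' * B₀) + γβ ≤ 5 * (d : ℝ) * L * B₈β) (β : ℝ) (len : Site d → ℝ)
    {J : Type} (ι : J → ZdIdx d L)
    (SB9src : ∀ a : J, ∀ α₀ α₁ α₂ : ℝ, 0 < α₀ → α₀ ≤ cP → 0 < α₁ → 0 < α₂ → α₂ ≤ cP →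
      ∀ (U₀ W : Site d → Fin d → 𝔸ˣ), (∀ x κ, U₀ x κ ∈ unitaryUnits 𝔸) → (∀ x κ, W x κ ∈ unitaryUnits 𝔸) →
      ∀ f : Site d → 𝔸, InR138 L (ι a).k (ι a).η ((ι a).Ω 0) ((ι a).Λs (ι a).k) U₀ f →
      msup L (ι a).k (ι a).η (-(2 : ℝ)) (fun j (x : Site d) => x ∈ (ι a).Ω j) f < γ * (α₀ + α₁) →
      msup L (ι a).k (ι a).η (-(3 : ℝ)) (fun j (p : Fin d × Site d) => p.2 ∈ (ι a).Ω j) (fun p => covDerivFwd (ι a).η U₀ p.1 f p.2) < γ * (α₀ + α₁) →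
      InAk L (ι a).k (ι a).η α₀ (ι a).Ω U₀ → InAk L (ι a).k (ι a).η α₀ (ι a).Ω (mulCfg W U₀) → IsLandau146W L (ι a).k (ι a).η ((ι a).Ω 0) ((ι a).Λs (ι a).k) U₀ f W →
      ∀ A' : Site d → Fin d → 𝔸, (∀ y τ, IsSelfAdjoint (A' y τ)) →
      (∀ j, j ≤ (ι a).k → ∀ (y : Site d) (τ : Fin d), SideTouches ((ι a).Ω j) y τ →
        W y τ = cfgExp (ι a).η A' y τ ∧ ‖A' y τ‖ ≤ α₂ * ((L : ℝ) ^ j * (ι a).η)⁻¹) →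
      (∀ (y : Site d) (τ : Fin d), (∀ j, j ≤ (ι a).k → ¬ SideTouches ((ι a).Ω j) y τ) → A' y τ = 0) →
      msup L (ι a).k (ι a).η (-(1 : ℝ)) (fun j (b : Site d × Fin d) => SideTouches ((ι a).Ω j) b.1 b.2) (fun b => A' b.1 b.2)
          ≤ B₀ * (bondNorm L (ι a).k (ι a).η (-(3 : ℝ)) (ι a).Ω (fun x μ => Jcur (ι a).η U₀ A' μ x)
            + wsup 1 (fun p : {p : ℕ × (Site d × Fin d) // p.1 ≤ (ι a).k ∧ p.2 ∈ (ι a).Λb (ι a).k p.1} =>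
                linCovIter L U₀ (iEta (ι a).η A') p.1.1 p.1.2.1 p.1.2.2)) + γ'' * B₀ * (α₀ + α₁) ∧
        msup L (ι a).k (ι a).η (-(2 : ℝ)) (fun j (t : Fin d × Fin d × Site d) => SideTouches ((ι a).Ω j) t.2.2 t.2.1)
            (fun t => covDerivFwd (ι a).η U₀ t.1 (fun z => A' z t.2.1) t.2.2)
          ≤ B₀ * (bondNorm L (ι a).k (ι a).η (-(3 : ℝ)) (ι a).Ω (fun x μ => Jcur (ι a).η U₀ A' μ x)
            + wsup 1 (fun p : {p : ℕ × (Site d × Fin d) // p.1 ≤ (ι a).k ∧ p.2 ∈ (ι a).Λb (ι a).k p.1} =>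
                linCovIter L U₀ (iEta (ι a).η A') p.1.1 p.1.2.1 p.1.2.2)) + γ'' * B₀ * (α₀ + α₁) ∧
        bondNorm L (ι a).k (ι a).η (-(3 : ℝ)) (ι a).Ω (fun x μ => pdiv (ι a).η U₀ (plaqCovDeriv (ι a).η U₀ A') μ x)
          ≤ B₀ * (bondNorm L (ι a).k (ι a).η (-(3 : ℝ)) (ι a).Ω (fun x μ => Jcur (ι a).η U₀ A' μ x)
            + wsup 1 (fun p : {p : ℕ × (Site d × Fin d) // p.1 ≤ (ι a).k ∧ p.2 ∈ (ι a).Λb (ι a).k p.1} =>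
                linCovIter L U₀ (iEta (ι a).η A') p.1.1 p.1.2.1 p.1.2.2)) + γ'' * B₀ * (α₀ + α₁) ∧
        bondNorm L (ι a).k (ι a).η (-(3 : ℝ)) (ι a).Ω (fun x μ => covLap (ι a).η U₀ (fun z => A' z μ) x)
          ≤ B₀ * (bondNorm L (ι a).k (ι a).η (-(3 : ℝ)) (ι a).Ω (fun x μ => Jcur (ι a).η U₀ A' μ x)
            + wsup 1 (fun p : {p : ℕ × (Site d × Fin d) // p.1 ≤ (ι a).k ∧ p.2 ∈ (ι a).Λb (ι a).k p.1} =>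
                linCovIter L U₀ (iEta (ι a).η A') p.1.1 p.1.2.1 p.1.2.2)) + γ'' * B₀ * (α₀ + α₁) ∧
        msup L (ι a).k (ι a).η (-(2 + β)) (fun j (q : Fin d × Fin d × (Site d × Site d)) => q.2.2 ∈ AdmPair (ι a).η len ∧ q.2.2.1 ∈ (ι a).Ω j)
            (fun q => hquot (ι a).η β len U₀ (covDerivFwd (ι a).η U₀ q.1 (fun z => A' z q.2.1)) q.2.2)
          ≤ B₀β * (bondNorm L (ι a).k (ι a).η (-(3 : ℝ)) (ι a).Ω (fun x μ => Jcur (ι a).η U₀ A' μ x)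
            + wsup 1 (fun p : {p : ℕ × (Site d × Fin d) // p.1 ≤ (ι a).k ∧ p.2 ∈ (ι a).Λb (ι a).k p.1} =>
                linCovIter L U₀ (iEta (ι a).η A') p.1.1 p.1.2.1 p.1.2.2)) + γβ * (α₀ + α₁)) :
    ∃ c : ℝ, 0 < c ∧ ∀ a : J, ∀ α₀ α₁ α₂ : ℝ, 0 < α₀ → α₀ ≤ c → 0 < α₁ → α₁ ≤ c → 0 < α₂ → α₂ ≤ c →
      2 * α₂ ^ 2 + 20 * d * α₀ * α₂ + 2 * (2097152 * ((d : ℝ) + 1) ^ 2) * α₂ ^ 2 ≤ α₀ + α₁ →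
      ∀ (U₀ : (zdGF3 𝔸 L β len (ι a)).Cfg) (P' : (zdGF3 𝔸 L β len (ι a)).Pert) (f : Site d → 𝔸),
        (zdGF3 𝔸 L β len (ι a)).InR U₀ f → (zdGF3 𝔸 L β len (ι a)).fNorm f < γ * (α₀ + α₁) → (zdGF3 𝔸 L β len (ι a)).fGrad U₀ f < γ * (α₀ + α₁) →
        (zdGF3 𝔸 L β len (ι a)).InA α₀ U₀ → (zdGF3 𝔸 L β len (ι a)).InAPair α₀ U₀ P' → (zdGF3 𝔸 L β len (ι a)).C162 1 α₂ U₀ P' →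
        (zdGF3 𝔸 L β len (ι a)).LandauF U₀ f P' → (zdGF3 𝔸 L β len (ι a)).C137 α₁ U₀ P' →
        (zdGF3 𝔸 L β len (ι a)).C136 (5 * d * L * B₈) (5 * d * L * B₈β) (α₀ + α₁) U₀ P' ∧
          (zdGF3 𝔸 L β len (ι a)).C139 (5 * d * L * B₈) (α₀ + α₁) U₀ P' := by
  have hL1 : 1 ≤ L := le_trans (by norm_num) hL
  have hLr : (1 : ℝ) ≤ L := by exact_mod_cast hL1
  have hB₀' : 0 ≤ B₀ := hB₀.le
  obtain ⟨cN, hcN, hwin⟩ := prop3_windows hd2 hL hB₀'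
  refine ⟨min cP cN, lt_min hcP hcN, ?_⟩
  intro a α₀ α₁ α₂ hα₀ hα₀c hα₁ _ hα₂ hα₂c h61 U₀ P f hInR hfN hfG hInA hPair h162 hLan h137
  have hα₀P : α₀ ≤ cP := hα₀c.trans (min_le_left _ _)
  have hα₂P : α₂ ≤ cP := hα₂c.trans (min_le_left _ _)
  obtain ⟨hα3, hα4, h16, hd5, hsmall, hc₃, hside, h50, hC⟩ :=
    hwin α₀ α₂ hα₀ (hα₀c.trans (min_le_right _ _)) hα₂.le (hα₂c.trans (min_le_right _ _))
  have hC₂' : 8 * (131072 * ((d : ℝ) + 1) ^ 2) * Real.exp (4 * (800 * ((d : ℝ) + 1) ^ 2 * ((d : ℝ) + 4)) * α₀) ≤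
      2097152 * ((d : ℝ) + 1) ^ 2 := hC
  have hS0 : 0 ≤ α₀ + α₁ := by linarith
  have hT0 : 0 ≤ γ'' * B₀ * (α₀ + α₁) := by positivity
  -- the data
  set W : Site d → Fin d → 𝔸ˣ := P.2.1 with hW_def
  have hWu : ∀ x κ, W x κ ∈ unitaryUnits 𝔸 := P.2.2
  have hU₀ : ∀ x κ, U₀.1 x κ ∈ unitaryUnits 𝔸 := U₀.2
  set A : Site d → Fin d → 𝔸 := mlogCfg (ι a).k (ι a).η (ι a).Ω W with hA_def
  -- (1.41) and self-adjointness of the canonical exponent; `W = e^{iηA}` on the `E j`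
  have h41 : ∀ j, j ≤ (ι a).k → ∀ (y : Site d) (τ : Fin d), SideTouches ((ι a).Ω j) y τ →
      W y τ = cfgExp (ι a).η A y τ ∧ ‖A y τ‖ ≤ α₂ * ((L : ℝ) ^ j * (ι a).η)⁻¹ := by
    intro j hj y τ hs
    obtain ⟨hexp, -, hbd⟩ := h162 j hj (y, τ) hs
    have hexp' : W y τ = cfgExp (ι a).η (logCfg (ι a).η W) y τ := hexp
    have hbd' : ‖logCfg (ι a).η W y τ‖ ≤ 1 * α₂ * ((L : ℝ) ^ j * (ι a).η)⁻¹ := hbd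
    have hAy : A y τ = logCfg (ι a).η W y τ := mlogCfg_of_sideTouches (ι a).η W hj hs
    refine ⟨?_, ?_⟩
    · rw [hexp']
      exact cfgExp_congr_at (ι a).η hAy.symm
    · rw [hAy]
      simpa only [one_mul] using hbd'
  have hAsa : ∀ y τ, IsSelfAdjoint (A y τ) := by
    intro y τ
    by_cases hmem : ∃ j, j ≤ (ι a).k ∧ SideTouches ((ι a).Ω j) y τ
    · obtain ⟨j, hj, hs⟩ := hmem
      rw [hA_def, mlogCfg_of_sideTouches (ι a).η W hj hs]
      exact (h162 j hj (y, τ) hs).2.1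
    · rw [hA_def, mlogCfg_of_not (ι a).η W fun j hj hs => hmem ⟨j, hj, hs⟩]
      exact IsSelfAdjoint.zero 𝔸
  have hA0 : ∀ (y : Site d) (τ : Fin d), (∀ j, j ≤ (ι a).k → ¬ SideTouches ((ι a).Ω j) y τ) → A y τ = 0 :=
    fun y τ h => mlogCfg_of_not (ι a).η W h
  -- (1.40)₁ for `e^{iηA}U₀` by locality; the Landau clause for `e^{iηA}` by locality
  have h40₁ : InAk L (ι a).k (ι a).η α₀ (ι a).Ω (mulCfg (expCfg (iEta (ι a).η A)) U₀.1) := by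
    refine (inAk_congr_of_sideTouches L (ι a).k (ι a).η α₀ (V := mulCfg W U₀.1) fun j hj y τ hs => ?_).1 hPair
    show W y τ * U₀.1 y τ = expCfg (iEta (ι a).η A) y τ * U₀.1 y τ
    rw [(h41 j hj y τ hs).1, expCfg_iEta_eq_cfgExp]
  -- the global bound and the gradient datum (bounded family)
  have hAglob : ∀ y τ, ‖A y τ‖ ≤ α₂ * (ι a).η⁻¹ := by
    intro y τ
    by_cases hmem : ∃ j, j ≤ (ι a).k ∧ SideTouches ((ι a).Ω j) y τ
    · obtain ⟨j, hj, hs⟩ := hmem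
      have hLj : (1 : ℝ) ≤ (L : ℝ) ^ j := one_le_pow₀ hLr
      have hη0 : 0 < (ι a).η := (ι a).hη
      calc ‖A y τ‖ ≤ α₂ * ((L : ℝ) ^ j * (ι a).η)⁻¹ := (h41 j hj y τ hs).2
        _ = α₂ * (ι a).η⁻¹ * ((L : ℝ) ^ j)⁻¹ := by rw [mul_inv]; ring
        _ ≤ α₂ * (ι a).η⁻¹ * 1 := by
            apply mul_le_mul_of_nonneg_left (inv_le_one_of_one_le₀ hLj) (by positivity)
        _ = α₂ * (ι a).η⁻¹ := mul_one _
    · rw [hA0 y τ fun j hj hs => hmem ⟨j, hj, hs⟩, norm_zero]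
      have hη0 : 0 < (ι a).η := (ι a).hη
      positivity
  have hU₀1 : ∀ x κ, U₀.1 x κ ∈ U1 𝔸 := fun x κ => unitaryUnits_le_U1 (hU₀ x κ)
  have hgrad : ∀ (y : Site d) (κ τ : Fin d), ‖covDerivFwd (ι a).η U₀.1 κ (fun z => A z τ) y‖ ≤ 2 * α₂ * (ι a).η⁻¹ * (ι a).η⁻¹ := by
    intro y κ τ
    have hη0 : 0 < (ι a).η := (ι a).hη
    unfold covDerivFwd
    rw [norm_smul, norm_inv, Real.norm_eq_abs, abs_of_pos hη0]
    have h1 : ‖B7Eq78Linearization.conjR (U₀.1 y κ) (A (y + e κ) τ) - A y τ‖ ≤ α₂ * (ι a).η⁻¹ + α₂ * (ι a).η⁻¹ := by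
      calc ‖B7Eq78Linearization.conjR (U₀.1 y κ) (A (y + e κ) τ) - A y τ‖
          ≤ ‖B7Eq78Linearization.conjR (U₀.1 y κ) (A (y + e κ) τ)‖ + ‖A y τ‖ := norm_sub_le _ _
        _ ≤ α₂ * (ι a).η⁻¹ + α₂ * (ι a).η⁻¹ := by
            rw [B8Ineq132.norm_conjR (hU₀1 y κ)]
            exact add_le_add (hAglob _ _) (hAglob _ _)
    calc (ι a).η⁻¹ * ‖B7Eq78Linearization.conjR (U₀.1 y κ) (A (y + e κ) τ) - A y τ‖ ≤ (ι a).η⁻¹ * (α₂ * (ι a).η⁻¹ + α₂ * (ι a).η⁻¹) :=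
        mul_le_mul_of_nonneg_left h1 (by positivity)
      _ = 2 * α₂ * (ι a).η⁻¹ * (ι a).η⁻¹ := by ring
  have hBg : Bdd L (ι a).k (ι a).η (-(2 : ℝ)) (fun j (t : Fin d × Fin d × Site d) => SideTouches ((ι a).Ω j) t.2.2 t.2.1)
      (fun t => covDerivFwd (ι a).η U₀.1 t.1 (fun z => A z t.2.1) t.2.2) := by
    have e2 : (-(2 : ℝ)) = -((2 : ℕ) : ℝ) := by norm_num
    rw [e2]
    refine B8ScaledSupNorm.bdd_of_forall (c := 2 * α₂ * ((L : ℝ) ^ (ι a).k) ^ 2) fun j hj t _ => ?_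
    rw [B8ScaledSupNorm.weight_neg_natCast L (ι a).η 2 j]
    have hLjk : (L : ℝ) ^ j ≤ (L : ℝ) ^ (ι a).k := pow_le_pow_right₀ hLr hj
    have hLj0 : (0 : ℝ) ≤ (L : ℝ) ^ j := by positivity
    have hη0 : 0 < (ι a).η := (ι a).hη
    calc ((L : ℝ) ^ j * (ι a).η) ^ 2 * ‖covDerivFwd (ι a).η U₀.1 t.1 (fun z => A z t.2.1) t.2.2‖
        ≤ ((L : ℝ) ^ j * (ι a).η) ^ 2 * (2 * α₂ * (ι a).η⁻¹ * (ι a).η⁻¹) := mul_le_mul_of_nonneg_left (hgrad _ _ _) (by positivity)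
      _ = 2 * α₂ * ((L : ℝ) ^ j) ^ 2 := by field_simp
      _ ≤ 2 * α₂ * ((L : ℝ) ^ (ι a).k) ^ 2 := by gcongr
  set g : ℝ := msup L (ι a).k (ι a).η (-(2 : ℝ)) (fun j (t : Fin d × Fin d × Site d) => SideTouches ((ι a).Ω j) t.2.2 t.2.1)
      (fun t => covDerivFwd (ι a).η U₀.1 t.1 (fun z => A z t.2.1) t.2.2) with hg_def
  have hg0 : 0 ≤ g := B8ScaledSupNorm.msup_nonneg L (ι a).k (ι a).hη.le _ _ _
  have hg : ∀ j, j ≤ (ι a).k → ∀ (y : Site d) (κ τ : Fin d), SideTouches ((ι a).Ω j) y τ →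
      ((L : ℝ) ^ j * (ι a).η) ^ 2 * ‖covDerivFwd (ι a).η U₀.1 κ (fun z => A z τ) y‖ ≤ g := by
    intro j hj y κ τ hs
    have h := B8ScaledSupNorm.weight_mul_norm_le_msup hBg hj (i := (κ, τ, y)) hs
    have hw : weight L (ι a).η (-(2 : ℝ)) j = ((L : ℝ) ^ j * (ι a).η) ^ 2 := by
      have e2 : (-(2 : ℝ)) = -((2 : ℕ) : ℝ) := by norm_num
      rw [e2, B8ScaledSupNorm.weight_neg_natCast L (ι a).η 2 j]
    rw [hw] at h
    exact h
  -- the Landau clause for `e^{iηA}` and the in-edge (1.59), five lines, from the socket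
  have hLanA : IsLandau146W L (ι a).k (ι a).η ((ι a).Ω 0) ((ι a).Λs (ι a).k) U₀.1 f W := hLan
  obtain ⟨h59a, h59g, h59j, h59l, h59h⟩ := SB9src a α₀ α₁ α₂ hα₀ hα₀P hα₁ hα₂ hα₂P U₀.1 W hU₀ hWu f hInR hfN hfG hInA hPair hLanA A
    hAsa h41 hA0
  -- (1.42) = the member's (1.37) clause, on the classified constraint bonds of the top truncation
  have hbox : ∀ j, j ≤ (ι a).k → ∀ c ∈ (ι a).Λb (ι a).k j, ∀ x, InBox (loK L j c.1) (bondHiK L j c.1 c.2) x → x ∈ (ι a).Ω j :=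
    fun j hj c hc x hx => (ι a).hbox (ι a).k le_rfl j hj c hc x hx
  have h42 : ∀ j, j ≤ (ι a).k → ∀ c ∈ (ι a).Λb (ι a).k j, ‖logCovIter L U₀.1 (iEta (ι a).η A) j c.1 c.2‖ < 2 * d * L * α₁ := h137
  have h41' : ∀ j, j ≤ (ι a).k → ∀ (y : Site d) (τ : Fin d), SideTouches ((ι a).Ω j) y τ → ‖A y τ‖ ≤ α₂ * ((L : ℝ) ^ j * (ι a).η)⁻¹ :=
    fun j hj y τ hs => (h41 j hj y τ hs).2
  -- PROPOSITION 3 at `k` levels (n05-b), all four members, and the Hölder member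
  obtain ⟨ha, hg', hj, hl⟩ := prop3_norms_kLevel_src4 hd2 (ι a).hη hL hU₀ hAsa hα₀ hα₁.le hα₂.le hg0 hα3 hα4 h16 hd5
    hsmall hc₃ hB₀' hside h50 hC₂' h61 hbox hInA h40₁ h41' hg h42 h59a h59g h59j h59l
  have hh := prop3_fifth_kLevel_src hd2 (ι a).hη hL hU₀ hAsa hα₀ hα₁.le hα₂.le hg0 hα3 hα4 h16 hd5 hsmall hc₃ hB₀' hB₀β
    hside h50 hC₂' h61 hbox hInA h40₁ h41' hg h42 hT0 h59g h59h
  -- the enlarged constants absorb the source terms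
  have hc8 : 5 * (d : ℝ) * L * B₀ * (α₀ + α₁) + (γ'' * B₀ * (α₀ + α₁) + γ'' * B₀ * (α₀ + α₁)) ≤ 5 * (d : ℝ) * L * B₈ * (α₀ + α₁) := by
    have h := mul_le_mul_of_nonneg_right hB8 hS0
    calc 5 * (d : ℝ) * L * B₀ * (α₀ + α₁) + (γ'' * B₀ * (α₀ + α₁) + γ'' * B₀ * (α₀ + α₁))
        = (5 * (d : ℝ) * L * B₀ + 2 * (γ'' * B₀)) * (α₀ + α₁) := by ring
      _ ≤ 5 * (d : ℝ) * L * B₈ * (α₀ + α₁) := h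
  have hc8β : 5 * (d : ℝ) * L * B₀β * (α₀ + α₁) + (2 * B₀β * (γ'' * B₀ * (α₀ + α₁)) + γβ * (α₀ + α₁)) ≤
      5 * (d : ℝ) * L * B₈β * (α₀ + α₁) := by
    have h := mul_le_mul_of_nonneg_right hB8β hS0
    calc 5 * (d : ℝ) * L * B₀β * (α₀ + α₁) + (2 * B₀β * (γ'' * B₀ * (α₀ + α₁)) + γβ * (α₀ + α₁))
        = (5 * (d : ℝ) * L * B₀β + 2 * B₀β * (γ'' * B₀) + γβ) * (α₀ + α₁) := by ring
      _ ≤ 5 * (d : ℝ) * L * B₈β * (α₀ + α₁) := h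
  have ha' : msup L (ι a).k (ι a).η (-(1 : ℝ)) (fun j (b : Site d × Fin d) => SideTouches ((ι a).Ω j) b.1 b.2) (fun b => A b.1 b.2) ≤
      5 * (d : ℝ) * L * B₈ * (α₀ + α₁) := ha.trans hc8
  refine ⟨⟨fun j hj b hb => ?_, hg'.trans (by linarith [hc8]), hh.trans hc8β⟩, hj.trans hc8, hl.trans hc8⟩
  -- (1.36)₁ pointwise on the `E j`, read on the logarithm
  obtain ⟨hexp, hsa, -⟩ := h162 j hj b hb
  refine ⟨hexp, hsa, ?_⟩
  have hpt := B8Thm2GaugeFixedKLevel.thm2_pointwise_A (ι a).hη hL1 h41' ha' hj (y := b.1) (τ := b.2) hb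
  rw [← mlogCfg_of_sideTouches (ι a).η W hj hb]
  exact hpt

end Zd3

#print axioms apriori_160_src4
#print axioms apriori_160_fifth_src
#print axioms prop3_norms_kLevel_src4
#print axioms prop3_fifth_kLevel_src
#print axioms sp3src_zd3_of_sockB9P3src
#print axioms sp3src_zd3_map_of_sockB9P3src

end Literature.MathematicalPhysics.QuantumFieldTheory.Balaban1983to89.B8Prop3SrcZd3

end
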